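import Literature.AlgebraicGeometry.Motives.CompleteIntersection
import HarnessLib

/-!
# Inclusions between reduced complete intersections `V₊(F) ↪ V₊(G)` in `ℙᵐ_k`

`Motives/CompleteIntersection` constructs, for a family of forms `F` in `k[x₀, …, x_m]`, the
common zero locus `V₊(F) ⊆ ℙᵐ_k` with its reduced induced closed subscheme structure as a
`k`-scheme `completeIntersection F`, with its closed `k`-immersion `completeIntersectionι F` into
`ℙᵐ_k` (Hartshorne II Example 3.2.6, Ex. 8.4). This file adds the evident functoriality: if
`V₊(F) ⊆ V₊(G)` as closed subsets of `ℙᵐ_k` (e.g. when every `G_b` is one of the `F_a`,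
`zeroLocusClosed_le_of_forall_exists`), the reduced induced structures come with a unique closed
`k`-immersion `completeIntersectionInclusion h : V₊(F) ↪ V₊(G)` over `ℙᵐ_k`
(`completeIntersectionInclusion_ι`; Hartshorne II Ex. 3.11 (c)–(d): the reduced induced structure
on a closed subset is the smallest closed subscheme structure, so a closed subset inclusion
`Y ⊆ Y'` induces `Y_red ↪ Y'_red`). It is Mathlib's `IdealSheafData.inclusion` for the
antitone vanishing ideal sheaves (`vanishingIdeal_antimono`).

The case in view: a complete intersection `V₊(Q, C)` of a quadric and a cubic inside the quadric
`V₊(Q)` (`quadricCubicToQuadric`), the pair `Y ⊂ Y'` of Hirschowitz–Iyer, Contemp. Math. 522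
(2010), §2 (`Motives/HirschowitzIyerQuadricCubic`), and `X ⊂` (quadric) in the route files on
`(2,3)` complete intersections.

## References

* R. Hartshorne, *Algebraic Geometry*, GTM 52 (1977), II Example 3.2.6 and II Ex. 3.11 (c), (d)
  (reduced induced structure and its minimality). [Hartshorne1977]
-/

noncomputable section

open CategoryTheory AlgebraicGeometry MvPolynomial TopologicalSpace

universe u v w

namespace Literature.AlgebraicGeometry.Motives

attribute [local instance] MvPolynomial.gradedAlgebra

variable {k : Type u} [Field k] {m : ℕ} {ι : Type v} {ι' : Type w}
  (F : ι → MvPolynomial (Fin (m + 1)) k) (G : ι' → MvPolynomial (Fin (m + 1)) k)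

namespace CompleteIntersection

/-- If every `G_b` is one of the `F_a`, then `V₊(F) ⊆ V₊(G)` (the zero locus is antitone in the
set of equations, Mathlib `ProjectiveSpectrum.zeroLocus_anti_mono`). [folklore] -/
theorem zeroLocusClosed_le_of_forall_exists (h : ∀ b, ∃ a, G b = F a) :
    zeroLocusClosed F ≤ zeroLocusClosed G := by
  intro p hp
  rw [mem_zeroLocusClosed_iff] at hp ⊢
  intro b
  obtain ⟨a, ha⟩ := h b
  rw [ha]
  exact hp a

/-- `V₊(F) ⊆ V₊(G)` makes the vanishing ideal sheaves satisfy `𝓘(V₊(G)) ≤ 𝓘(V₊(F))`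
(Mathlib `vanishingIdeal_antimono`). [folklore] -/
theorem idealSheaf_le_of_le (h : zeroLocusClosed F ≤ zeroLocusClosed G) :
    idealSheaf G ≤ idealSheaf F :=
  Scheme.IdealSheafData.vanishingIdeal_antimono h

end CompleteIntersection

open CompleteIntersection

/-- **The inclusion `V₊(F) ↪ V₊(G)` of reduced complete intersections** for `V₊(F) ⊆ V₊(G)`
(closed subsets of `ℙᵐ_k`), as a morphism of `k`-schemes: Mathlib's `IdealSheafData.inclusion`
for `𝓘(V₊(G)) ≤ 𝓘(V₊(F))`. It commutes with the embeddings into `ℙᵐ_k`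
(`completeIntersectionInclusion_ι`) and is a closed immersion (Hartshorne II Ex. 3.11 (c), (d):
minimality and functoriality of the reduced induced structure). [cite: Hartshorne1977, II Ex. 3.11 (c)–(d)] -/
def completeIntersectionInclusion (h : zeroLocusClosed F ≤ zeroLocusClosed G) :
    completeIntersection F ⟶ completeIntersection G :=
  Over.homMk (Scheme.IdealSheafData.inclusion (idealSheaf_le_of_le F G h)) (by
    change Scheme.IdealSheafData.inclusion _ ≫ (idealSheaf G).subschemeι ≫ (projectiveSpace m k).hom =
      (idealSheaf F).subschemeι ≫ (projectiveSpace m k).hom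
    rw [← Category.assoc, Scheme.IdealSheafData.inclusion_subschemeι])

/-- The underlying morphism of `completeIntersectionInclusion` is Mathlib's
`IdealSheafData.inclusion` (`rfl`). [folklore] -/
@[simp]
theorem completeIntersectionInclusion_left (h : zeroLocusClosed F ≤ zeroLocusClosed G) :
    (completeIntersectionInclusion F G h).left =
      Scheme.IdealSheafData.inclusion (idealSheaf_le_of_le F G h) :=
  rfl

/-- **Compatibility with the embeddings into `ℙᵐ_k`**: `V₊(F) ↪ V₊(G) ↪ ℙᵐ_k` is `V₊(F) ↪ ℙᵐ_k`.
[folklore] -/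
@[reassoc (attr := simp)]
theorem completeIntersectionInclusion_ι (h : zeroLocusClosed F ≤ zeroLocusClosed G) :
    completeIntersectionInclusion F G h ≫ completeIntersectionι G = completeIntersectionι F := by
  ext : 1
  change Scheme.IdealSheafData.inclusion _ ≫ (idealSheaf G).subschemeι = (idealSheaf F).subschemeι
  exact Scheme.IdealSheafData.inclusion_subschemeι _

/-- The same compatibility on underlying schemes. [folklore] -/
@[reassoc]
theorem completeIntersectionInclusion_left_ι (h : zeroLocusClosed F ≤ zeroLocusClosed G) :
    (completeIntersectionInclusion F G h).left ≫ (completeIntersectionι G).left =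
      (completeIntersectionι F).left := by
  rw [← Over.comp_left, completeIntersectionInclusion_ι]

/-- `V₊(F) ↪ V₊(G)` is a closed immersion (its composite with the closed immersion
`V₊(G) ↪ ℙᵐ_k` is the closed immersion `V₊(F) ↪ ℙᵐ_k`). [folklore] -/
instance isClosedImmersion_completeIntersectionInclusion_left
    (h : zeroLocusClosed F ≤ zeroLocusClosed G) :
    IsClosedImmersion (completeIntersectionInclusion F G h).left := by
  haveI : IsClosedImmersion
      ((completeIntersectionInclusion F G h).left ≫ (completeIntersectionι G).left) := by
    rw [completeIntersectionInclusion_left_ι]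
    infer_instance
  exact IsClosedImmersion.of_comp_isClosedImmersion _ (completeIntersectionι G).left

/-- The image of `V₊(F) ↪ V₊(G)` consists of the points of `V₊(G)` lying on `V₊(F) ⊆ ℙᵐ_k`.
[folklore] -/
theorem range_completeIntersectionInclusion_left (h : zeroLocusClosed F ≤ zeroLocusClosed G) :
    Set.range (completeIntersectionInclusion F G h).left =
      (completeIntersectionι G).left ⁻¹'
        ProjectiveSpectrum.zeroLocus (MvPolynomial.homogeneousSubmodule (Fin (m + 1)) k)
          (Set.range F) := by
  have hinj : Function.Injective (completeIntersectionι G).left :=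
    (completeIntersectionι G).left.isClosedEmbedding.injective
  ext y
  constructor
  · rintro ⟨x, rfl⟩
    rw [Set.mem_preimage, ← range_completeIntersectionι F, ← Scheme.Hom.comp_apply,
      completeIntersectionInclusion_left_ι]
    exact ⟨x, rfl⟩
  · intro hy
    rw [Set.mem_preimage, ← range_completeIntersectionι F] at hy
    obtain ⟨x, hx⟩ := hy
    refine ⟨x, hinj ?_⟩
    rw [← Scheme.Hom.comp_apply, completeIntersectionInclusion_left_ι, hx]

/-! ### The pair `V₊(Q, C) ⊂ V₊(Q)` -/

/-- `V₊(Q, C) ⊆ V₊(Q)`: the complete intersection of a quadric and a cubic (indeed of any two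
forms) lies on the first hypersurface. [folklore] -/
theorem zeroLocusClosed_vecCons_le {n : ℕ} (Q C : MvPolynomial (Fin (n + 1)) k) :
    zeroLocusClosed ![Q, C] ≤ zeroLocusClosed (fun _ : Fin 1 => Q) :=
  zeroLocusClosed_le_of_forall_exists _ _ fun _ => ⟨0, rfl⟩

/-- **The closed `k`-immersion `V₊(Q, C) ↪ V₊(Q)`** of the (reduced) complete intersection of two
forms into the (reduced) hypersurface of the first — the pair `Y ⊂ Y'` of a divisor in a
hypersurface (Hirschowitz–Iyer 2010, §2, for a quadric `Q` and a cubic `C` on `ℙ⁸`).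
[folklore] -/
def quadricCubicToQuadric {n : ℕ} (Q C : MvPolynomial (Fin (n + 1)) k) :
    completeIntersection ![Q, C] ⟶ completeIntersection (fun _ : Fin 1 => Q) :=
  completeIntersectionInclusion _ _ (zeroLocusClosed_vecCons_le Q C)

/-- `V₊(Q, C) ↪ V₊(Q) ↪ ℙⁿ_k` is `V₊(Q, C) ↪ ℙⁿ_k`. [folklore] -/
@[reassoc (attr := simp)]
theorem quadricCubicToQuadric_ι {n : ℕ} (Q C : MvPolynomial (Fin (n + 1)) k) :
    quadricCubicToQuadric Q C ≫ completeIntersectionι (fun _ : Fin 1 => Q) =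
      completeIntersectionι ![Q, C] :=
  completeIntersectionInclusion_ι _ _ _

/-- `V₊(Q, C) ↪ V₊(Q)` is a closed immersion. [folklore] -/
instance isClosedImmersion_quadricCubicToQuadric_left {n : ℕ} (Q C : MvPolynomial (Fin (n + 1)) k) :
    IsClosedImmersion (quadricCubicToQuadric Q C).left :=
  isClosedImmersion_completeIntersectionInclusion_left _ _ _

end Literature.AlgebraicGeometry.Motives

end
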